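import Literature.NumberTheory.LFunctions.DeuringHeilbronnTwoModuli
import Mathlib

/-!
# Route `PrimeLevelFamEdge` — TYPED IDEA DELTAS, deck 34 (LANDING NOTE typer ls-idea-typ-1 gen 4: lens-13 g13's
# `HOME/ls-idea-lens-13/g13/Sketch_G13_DHWindowChiFace.lean` sha16 67509273a44bd04c VERBATIM up to namespace `Summit.Parity.GeneralizedHardyLittlewood.Sketch.Wuc13G13`
# → `…Theorems.PrimeLevelFamEdgeIdeaDeltas.DHWindowChiFace`; K-L13-15 = rider on K-L21-10 (deck 32); E b27 PASS «rider LOCATED, value LOW»;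
# landed at the typer's discretion for the cell record.)
#
# Sketch (cell ls-idea, seat lens-13 = I8-PRETENTIOUS × LENSES-v3 `wuc`, gen 13) —
# DH-WINDOW DISCHARGE OF THE χ-FACE HEDGE IN WORLD (A)

OMEGA-BLUEPRINT node **L5′ `OffDiagTransition` ≡ U**, band R⋆ / (S) rows, crux of record K_B =
`Summit.Parity.GeneralizedHardyLittlewood.Theses.PrimeLevelFamEdge.BeyondDiagonalBeatsQuarter`
(stmt-Parity-20343; heart stub `stub_offDiagBelowSlack_io`, line `diagonal_kernel_split` REV 4); crux idea of the
seat `l6-davenport-spacing-dichotomy` (tree rev 3.3a 4826039c9a3177e6).  Bears on lens-21's K-L21-10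
`l21-layer-twist-chi-face` (deck 32 `Theorems/PrimeLevelFamEdgeIdeaDeltasLayerTwist.lean`), whose χ-face of the
(S) rows under ordering β is priced as the world-∅ HEDGE

  `ChiFaceLL C s η N := ∀ d χ (1 < d ≤ N^η) ρ, L(ρ,χ) = 0 → |Im ρ| ≤ (log N)^s → Re ρ < 1 → Re ρ ≤ 1 − C·log log N/log N`,
  `ChiFaceLLIO C s η := ∀ N₀, ∃ N ≥ N₀, ChiFaceLL C s η N`   (OPEN; lens-21 g8 `Sketch_L21g8_LayerTwist.lean` :105–:112),

plus the ψ₁-EPOCH term σ₁ of the exceptional character's own row (world (A) only).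

WHAT THIS FILE PROVES (sorry-free; corollaries of the tree's PROVED two-moduli Deuring–Heilbronn theorem
`Literature.NumberTheory.LFunctions.DeuringHeilbronnTwoModuli.deuring_heilbronn_twoModuli`, Linnik 1944 / Bombieri, *Le grand crible* §6
Théorème 14, DISCHARGED in `RHWave0DeuringHeilbronnProofs.lean`):

* `strip_of_exceptional_of_window` — the WINDOW LEMMA.  With the absolute `c₁, c₂ > 0` of Deuring–Heilbronn: if
  `χ₁` mod `D` is real with a real zero `β₁ < 1`, `δ₁ := 1 − β₁`, and a target width `w ≥ 0` and a modulus budget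
  `M` satisfy the window inequality `(w/c₂)·log M ≤ log(c₁/(δ₁·log M))` (⟺ `δ₁ · log M · M^{w/c₂} ≤ c₁`), then
  EVERY zero `ρ ≠ β₁`, `0 < Re ρ < 1`, of EVERY `L(s, θ)`, `θ` any character mod `r`, with `D·r·(2 + |Im ρ|) ≤ M`,
  has `Re ρ ≤ 1 − w`.  Proof = monotonicity: `X(u) := log(c₁/(δ₁ u))` decreases and `(w/c₂)·u` increases in
  `u = log(D r (2+|Im ρ|)) ≤ log M`, so DH's `Re ρ ≤ 1 − c₂ X(u)/u` gives `≤ 1 − w`.  No derivative, no constant chased.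
* `window_of_product_le` / `dhWindow_of_product_le` — the window inequality from its product form
  `δ₁ · log M · M^{w/c₂} ≤ c₁` (bookkeeping).
* `chiFaceLLExcept_of_exceptional_of_window` — the χ-FACE SPECIALISATION.  With `w = C·log log N/log N ∈ [0,1]`
  and the box budget `M = D·N^η·(2 + (log N)^s)`: the window inequality `DHWindow c₁ c₂ D δ₁ C s η N` implies
  `ChiFaceLLExcept β₁ C s η N` = lens-21's `ChiFaceLL C s η N` VERBATIM with ONE extra binder `ρ ≠ β₁`
  (zeros with `Re ρ ≤ 0` are handled by `w ≤ 1`).  Below the exceptional modulus (`N^η < D`) the extra binder is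
  automatic for `θ ≠ χ₀` (tree `exists_LFunction_exceptionalPoint_ne_zero`, Landau–Page) — not used here.

PENCIL (docstring only, not typed): (i) WINDOW SIZE.  For `D ≤ N^η`, `log M ≈ 2ηL` (`L = log N`) and
`M^{w/c₂} ≈ L^{2ηC/c₂}`, so the window reads `δ₁ ≲ c₁/(2η·L^{1+κ})`, `κ := 2ηC/c₂`: window top
`L₊ ≈ (c₁/(2ηδ₁))^{1/(1+κ)}`; for `D > N^η` a lower end `L₋ ≈ (2C/c₂)·log D·(log L/X_D)` appears
(`X_D = log(c₁/(δ₁ log D))`).  In the route's (A)-LOG currency (lens-7 U-C `ExcSequence A₀`: ‖L(1,χ_D)‖ ≤ (log D)^{−A₀},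
whence `δ₁ ≤ C'(log D)^{−A₀}` by the PROVED U-B `smallLOneForcesRealZero_holds`, deck 28b) the window is
`(2C/(c₂(A₀−1)))·log D ≲ L ≲ (log D)^{A₀/(1+κ)}` (up to constants and log log factors), non-empty for large `D` as
soon as `A₀ > 1 + κ` (lens-21 needs `C ≈ deg P + 1 ≈ 2 + s`, so `κ = 2η(2+s)/c₂`); Siegel's theorem
(`δ₁ ≫_ε D^{−ε}`) does NOT void it (polylog-in-`N` currency) — contrast the ζ-FACE of band R⋆, which needs POWER
width `η/(2Δ′)` hence `δ₁ ≤ M^{−η/(2Δ′c₂)}`: (A)-POWER VOID by Siegel on the io rail, (A)-LOG DEAD (lens-7 v2.4.x,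
CELL-RECORD §3(3c)).  (ii) WINDOW ⊂ EPOCH.  The ψ₁-row exceeds the slack only on the epoch `δ₁L ≤ (deg P+1)·log L`
(lens-21 g8), i.e. `L ≲ (deg P+1)·δ₁⁻¹·log δ₁⁻¹`; since `L₊ ≈ δ₁^{−1/(1+κ)} ≪ δ₁⁻¹`, every DH window lies inside
χ₁'s epoch: ON-WINDOW the χ-face residual is σ₁ ALONE (all other characters, and ζ up to height (log N)^s, are
repelled to the log-log strip); OFF-WINDOW it is the world-∅ hedge `ChiFaceLLIO` (OPEN) as before.  (iii) When
`D` exceeds the (S)-row conductor range (the window's lower part: `D > N^{3η}` in E's (S) normalisation, `d ≤ N^η`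
in lens-21's box), χ₁ is not an (S)-row character at all: σ₁ is absent, and the extra binder `ρ ≠ β₁` is automatic
for every `θ ≠ χ₀` of conductor `< D` by Landau–Page (tree `exists_LFunction_exceptionalPoint_ne_zero`, `β₁` in
the Page range `1 − c/log(4·D·N^η)` — automatic in (A)-LOG) and for `θ = χ₀` by `ζ(β₁) < 0` on `(0,1)`: there the
χ-face is CLEAN outright (pencil; not typed here).

DELTA vs the cell's existing world-(A) objects: lens-7 deck 28 `excZeroPowerSum_le_rpow/_powK` = the same Linnik
repulsion on the POWER rail (level `P`, floor `K·P^{c_D η} ≤ 1`, ordering-β zero power sums; VOID/DEAD for the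
ζ-face); lens-7 deck 28b `dhWindowClean_holds` = REAL zeros only, classical width `a₀/log N`, conductors `< D`
(Landau–Page, not DH); lens-21 rev 2 `chiFaceLL_smallConductor_of_zeroFreeRegionUpTo` = world-∅, conductors
`d ≤ N^{1/(RC log L)}` from the classical region.  Here: ALL zeros, log-log width, ALL conductors `≤ N^η`, from DH,
in world (A), on LOG windows.  I8 reading: DH ⟸ the pretentious structure `χ₁ ≈ μ` on primes `≪ D^{O(1)}`
(λ = 1⋆χ₁ lacunary; [cite: IwaniecConversations2006, §9 (9.5)–(9.6)], the route the tree's own DH proof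
`RHWave0DeuringHeilbronnProofs.lean` follows) — the analytic face of the lens.

VALUE (self-assessed LOW, located): K_B's disposition FRONTIER-BY-BARRIER (`Literature.Barriers.Parity.
PrimeLevelTransitionZeroFreeBox`, `fundingBoxIO_iff_quasiRH`) is UNCHANGED — the ζ-face of band R⋆ is untouched; the
χ-face HEDGE becomes a theorem on the DH-LOG windows of world (A) and stays a world-∅ debt elsewhere.

HONESTY.  The exceptional zero is a HYPOTHESIS (binders `χ₁ ^ 2 = 1`, `β₁ < 1`, `χ₁.LFunction β₁ = 0`) and so is
the window inequality; nothing here bounds U, R⋆, (S) or any dual term of `stub_offDiagBelowSlack_io`; no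
exceptional-zero theorem (no Landau–Siegel / Siegel-zero exclusion, no Theorem 1–2 of arXiv:2211.02515, no repaired
Margin232) is proved by ideation; typed ≠ proved except the two kernel theorems below; located ≠ endorsed.
-/

noncomputable section

open Real

namespace Summit.Parity.GeneralizedHardyLittlewood.Theorems.PrimeLevelFamEdgeIdeaDeltas.DHWindowChiFace

/-- **Window lemma (Deuring–Heilbronn ⇒ a uniform strip).** With the absolute constants `c₁, c₂ > 0` of
`Literature.NumberTheory.LFunctions.DeuringHeilbronnTwoModuli.deuring_heilbronn_twoModuli`: an exceptional real zero `β₁` of a real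
`χ₁` mod `D`, a width `w ≥ 0` and a budget `M` with `(w/c₂)·log M ≤ log(c₁/((1 − β₁)·log M))` force
`Re ρ ≤ 1 − w` for every zero `ρ ≠ β₁`, `0 < Re ρ < 1`, of every `L(s,θ)`, `θ` mod `r`, with
`D·r·(2 + |Im ρ|) ≤ M`. [cite: Linnik1944] [cite: Bombieri1987GrandCrible, §6 Théorème 14] -/
theorem strip_of_exceptional_of_window :
    ∃ c₁ c₂ : ℝ, 0 < c₁ ∧ 0 < c₂ ∧
      ∀ (D r : ℕ) [NeZero D] [NeZero r] (χ₁ : DirichletCharacter ℂ D), χ₁ ^ 2 = 1 →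
      ∀ β₁ : ℝ, β₁ < 1 → χ₁.LFunction β₁ = 0 →
      ∀ (w M : ℝ), 0 ≤ w →
        w / c₂ * Real.log M ≤ Real.log (c₁ / ((1 - β₁) * Real.log M)) →
      ∀ (θ : DirichletCharacter ℂ r) (ρ : ℂ), θ.LFunction ρ = 0 → 0 < ρ.re → ρ.re < 1 →
        ρ ≠ β₁ → (D : ℝ) * r * (2 + |ρ.im|) ≤ M → ρ.re ≤ 1 - w := by
  obtain ⟨c₁, c₂, hc₁, hc₂, H⟩ :=
    Literature.NumberTheory.LFunctions.DeuringHeilbronnTwoModuli.deuring_heilbronn_twoModuli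
  refine ⟨c₁, c₂, hc₁, hc₂,
    fun D r _ _ χ₁ hχ₁ β₁ hβ₁ hz₁ w M hw hwin θ ρ hρ hre0 hre1 hne hM ↦ ?_⟩
  have key := H D r χ₁ hχ₁ β₁ hβ₁ hz₁ θ ρ hρ hre0 hre1 hne
  set Mρ : ℝ := (D : ℝ) * r * (2 + |ρ.im|) with hMρ_def
  have hD1 : (1 : ℝ) ≤ D := by exact_mod_cast Nat.pos_of_neZero D
  have hr1 : (1 : ℝ) ≤ r := by exact_mod_cast Nat.pos_of_neZero r
  have hMρ2 : (2 : ℝ) ≤ Mρ := by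
    have h2 : (2 : ℝ) ≤ 2 + |ρ.im| := by linarith [abs_nonneg ρ.im]
    have hDr : (1 : ℝ) ≤ (D : ℝ) * r := by nlinarith
    have : (1 : ℝ) * 2 ≤ (D : ℝ) * r * (2 + |ρ.im|) :=
      mul_le_mul hDr h2 (by norm_num) (by positivity)
    linarith
  have hMρpos : 0 < Mρ := by linarith
  have huρ : 0 < Real.log Mρ := Real.log_pos (by linarith)
  have huM : Real.log Mρ ≤ Real.log M := Real.log_le_log hMρpos hM
  have hδ : 0 < 1 - β₁ := by linarith
  -- `X(log M) ≤ X(log Mρ)` : the repulsion numerator only improves when the budget shrinks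
  have hX : Real.log (c₁ / ((1 - β₁) * Real.log M)) ≤
      Real.log (c₁ / ((1 - β₁) * Real.log Mρ)) := by
    have huMpos : 0 < Real.log M := huρ.trans_le huM
    apply Real.log_le_log (div_pos hc₁ (mul_pos hδ huMpos))
    exact div_le_div_of_nonneg_left hc₁.le (mul_pos hδ huρ) (mul_le_mul_of_nonneg_left huM hδ.le)
  -- `(w/c₂)·log Mρ ≤ X(log Mρ)`
  have h1 : w / c₂ * Real.log Mρ ≤ Real.log (c₁ / ((1 - β₁) * Real.log Mρ)) :=
    calc w / c₂ * Real.log Mρ ≤ w / c₂ * Real.log M :=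
          mul_le_mul_of_nonneg_left huM (div_nonneg hw hc₂.le)
      _ ≤ _ := hwin.trans hX
  -- hence `w ≤ c₂ · X(log Mρ) / log Mρ`
  have h2 : w ≤ c₂ * Real.log (c₁ / ((1 - β₁) * Real.log Mρ)) / Real.log Mρ := by
    rw [le_div_iff₀ huρ]
    have h3 := mul_le_mul_of_nonneg_left h1 hc₂.le
    have hc : c₂ * (w / c₂ * Real.log Mρ) = w * Real.log Mρ := by
      field_simp
    linarith
  linarith

/-- lens-21's χ-face box `ChiFaceLL C s η N` (K-L21-10, `Sketch_L21g8_LayerTwist.lean` :105) VERBATIM with ONE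
extra binder `ρ ≠ β₁` (the exceptional point itself): conductors `1 < d ≤ N^η`, zeros of height `≤ (log N)^s`,
`Re ρ < 1`, repelled to `Re ρ ≤ 1 − C·log log N/log N`. -/
def ChiFaceLLExcept (β₁ C s η N : ℝ) : Prop :=
  ∀ (d : ℕ) [NeZero d] (χ : DirichletCharacter ℂ d), 1 < d → (d : ℝ) ≤ N ^ η →
    ∀ ρ : ℂ, χ.LFunction ρ = 0 → |ρ.im| ≤ Real.log N ^ s → ρ.re < 1 → ρ ≠ β₁ →
      ρ.re ≤ 1 - C * (Real.log (Real.log N) / Real.log N)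

/-- The box budget `M = D·N^η·(2 + (log N)^s)`: it dominates `D·d·(2 + |Im ρ|)` for every (S)-row datum
`d ≤ N^η`, `|Im ρ| ≤ (log N)^s`. -/
def boxBudget (D : ℕ) (s η N : ℝ) : ℝ := (D : ℝ) * N ^ η * (2 + Real.log N ^ s)

/-- The Deuring–Heilbronn LOG window at scale `N` for exceptional data `(D, δ₁)` and target width
`w = C·log log N/log N`: `(w/c₂)·log M ≤ log(c₁/(δ₁·log M))`, `M = boxBudget D s η N`
(⟺ `δ₁ · log M · M^{w/c₂} ≤ c₁`; pencil: `δ₁ ≲ c₁/(2η·(log N)^{1 + 2ηC/c₂})` when `D ≤ N^η`). -/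
def DHWindow (c₁ c₂ : ℝ) (D : ℕ) (δ₁ C s η N : ℝ) : Prop :=
  C * (Real.log (Real.log N) / Real.log N) / c₂ * Real.log (boxBudget D s η N) ≤
    Real.log (c₁ / (δ₁ * Real.log (boxBudget D s η N)))

/-- The window inequality in product form: `δ₁ · log M · M^{w/c₂} ≤ c₁` (with `M^{w/c₂} = exp((w/c₂) log M)`,
`M > 1`, `δ₁ > 0`) implies `(w/c₂)·log M ≤ log(c₁/(δ₁·log M))`. [folklore] -/
theorem window_of_product_le {c₁ c₂ δ₁ w M : ℝ} (hδ : 0 < δ₁) (hM : 1 < M)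
    (h : δ₁ * Real.log M * Real.exp (w / c₂ * Real.log M) ≤ c₁) :
    w / c₂ * Real.log M ≤ Real.log (c₁ / (δ₁ * Real.log M)) := by
  have hlogM : 0 < Real.log M := Real.log_pos hM
  have hA : 0 < δ₁ * Real.log M := mul_pos hδ hlogM
  have h' : Real.exp (w / c₂ * Real.log M) ≤ c₁ / (δ₁ * Real.log M) := by
    rw [le_div_iff₀ hA]
    linarith
  have := Real.log_le_log (Real.exp_pos _) h'
  rwa [Real.log_exp] at this

/-- `DHWindow` from the product form `δ₁ · log M · M^{w/c₂} ≤ c₁`, `M = boxBudget D s η N > 1`,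
`w = C·log log N/log N`. [folklore] -/
theorem dhWindow_of_product_le {c₁ c₂ : ℝ} {D : ℕ} {δ₁ C s η N : ℝ} (hδ : 0 < δ₁)
    (hM : 1 < boxBudget D s η N)
    (h : δ₁ * Real.log (boxBudget D s η N) *
      Real.exp (C * (Real.log (Real.log N) / Real.log N) / c₂ * Real.log (boxBudget D s η N)) ≤ c₁) :
    DHWindow c₁ c₂ D δ₁ C s η N :=
  window_of_product_le hδ hM h

/-- **χ-face on a DH window.** With the absolute `c₁, c₂ > 0` of the window lemma: an exceptional real zero
`β₁ < 1` of a real `χ₁` mod `D`, a width `0 ≤ C·log log N/log N ≤ 1`, and the window `DHWindow c₁ c₂ D (1 − β₁) C s η N`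
give `ChiFaceLLExcept β₁ C s η N` — every zero but `β₁` of every `L(s,χ)`, `1 < cond-level d ≤ N^η`, of height
`≤ (log N)^s`, lies in `Re ρ ≤ 1 − C·log log N/log N`. [cite: Linnik1944] [cite: Bombieri1987GrandCrible, §6 Théorème 14] -/
theorem chiFaceLLExcept_of_exceptional_of_window :
    ∃ c₁ c₂ : ℝ, 0 < c₁ ∧ 0 < c₂ ∧
      ∀ (D : ℕ) [NeZero D] (χ₁ : DirichletCharacter ℂ D), χ₁ ^ 2 = 1 →
      ∀ β₁ : ℝ, β₁ < 1 → χ₁.LFunction β₁ = 0 →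
      ∀ C s η N : ℝ, 0 ≤ C * (Real.log (Real.log N) / Real.log N) →
        C * (Real.log (Real.log N) / Real.log N) ≤ 1 →
        DHWindow c₁ c₂ D (1 - β₁) C s η N → ChiFaceLLExcept β₁ C s η N := by
  obtain ⟨c₁, c₂, hc₁, hc₂, H⟩ := strip_of_exceptional_of_window
  refine ⟨c₁, c₂, hc₁, hc₂, fun D _ χ₁ hχ₁ β₁ hβ₁ hz₁ C s η N hw0 hw1 hwin ↦ ?_⟩
  intro d _ χ hd hdN ρ hρ him hre1 hne
  by_cases hre0 : 0 < ρ.re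
  · refine H D d χ₁ hχ₁ β₁ hβ₁ hz₁ _ (boxBudget D s η N) hw0 hwin χ ρ hρ hre0 hre1 hne ?_
    -- `D·d·(2 + |Im ρ|) ≤ D·N^η·(2 + (log N)^s)`
    have hd1 : (1 : ℝ) < d := by exact_mod_cast hd
    have hD0 : (0 : ℝ) ≤ D := by positivity
    have hNη : 0 ≤ N ^ η := by linarith
    unfold boxBudget
    exact mul_le_mul (mul_le_mul_of_nonneg_left hdN hD0) (by linarith) (by positivity)
      (mul_nonneg hD0 hNη)
  · linarith [not_lt.mp hre0]

end Summit.Parity.GeneralizedHardyLittlewood.Theorems.PrimeLevelFamEdgeIdeaDeltas.DHWindowChiFace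

end
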